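import Summits.CriticalPhenomena.CardyFormulaZ2.Theses.CardyComplexCone
import Literature.Probability.LatticeModels.ExplorationWinding

/-!
# Sketch — crux ideas for `EdgeCoherence` (stmt-CriticalPhenomena-11385), ideator 2, round 1 (gen 1 + gen 2)

First lemmas of the two idea cards, typed over existing declarations (nothing is proved here).

* Card `spin-aliasing-vertex-mode`: `HarmonicVanishing` (the three non-trivial ℤ₄-harmonics of the
  class vector — the spin-2/3, 5/3, 4/3 aliases of the spin-1/3 corner observable — are `o(δ^{1/3})`)
  and the first lemma `HarmonicVanishing → EdgeCoherence` (exact ℤ₄-Fourier inversion, u ≡ 1).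
* Card `lee-yang-winding-fugacity`: the deterministic Aissen–Schoenberg–Whitney/Edrei monotonicity
  lemma `RealRootedModulusAntitone` and the probabilistic bet `WindingIndexRealRooted` (the generating
  Laurent polynomial of the lifted quarter-turn index of the darts used at a bulk vertex has only real
  non-positive zeros), plus the positive-fugacity ratio limit `TiltedClassEquidistribution`.
* Card `fixed-radius-equivariant-cut` (generation 2): the δ-FREE inner response tensor `innerResp ρ e c`
  of the lattice ball of radius `ρ` (forward medial orbit from a boundary corner `e` reaching the
  centre corner `(0,c)` inside the ball, spin-1/3 phase of its turning), its ℤ₄-harmonics, the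
  transfer target `InnerUniformCoherence`, the one-cut presentation `OneCutPresentation` (exact
  factorisation identity + outer absolute envelope + multi-excursion remainder) and the first lemma
  `FirstLemmaOneCut : OneCutPresentation → InnerUniformCoherence → HarmonicVanishing`; plus the
  algebraic core `OneCutHarmonicBound` and `InnerRespEquivariant` (both provable now).
-/

namespace Summit.CriticalPhenomena.CardyFormulaZ2.Cruxes.EdgeCoherence.Sketch

open scoped BigOperators Topology
open Filter Set MeasureTheory
open Literature.Probability.LatticeModels Literature.Probability.RandomPlanarGeometry
  Literature.Probability.Percolation
open Summit.CriticalPhenomena.CardyFormulaZ2.Theses.CardyComplexCone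

noncomputable section

/-- Cyclic (counter-clockwise) index of a corner class: the offset `o = f - v ∈ {0,-e₀,-e₀-e₁,-e₁}`
of the face `f` cornered at `v` is sent to `0, 1, 2, 3` = travel directions NW, SW, SE, NE of the dart
`(v,f)` (consecutive darts around `v` differ by a left quarter-turn). Junk `0` off the four offsets. -/
def cornerIndex (o : Site 2) : ℕ :=
  if o = 0 then 0
  else if o = -(Pi.single 0 1) then 1
  else if o = -(Pi.single 0 1) - Pi.single 1 1 then 2
  else if o = -(Pi.single 1 1) then 3 else 0

/-- The four faces cornered at the primal vertex `v`, listed counter-clockwise starting NE. -/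
def cornerFaces (v : Site 2) : Fin 4 → Site 2 :=
  ![v, v - Pi.single 0 1, v - Pi.single 0 1 - Pi.single 1 1, v - Pi.single 1 1]

/-- The spin-1/3 corner observable of the route, `E_δ(v,f)` for the discretisation family `Λ`
(verbatim the `let E` of `EdgeCoherence`). -/
def cornerObs (Λ : ℝ → DiscreteDobrushin) (δ : ℝ) (v f : Site 2) : ℂ :=
  ∫ ω, (let γ := medialExploration (Λ δ) ω;
    ∑ k ∈ (Finset.range γ.length).filter
      (fun k => γ[k]? = some (cornerSource v f) ∧ γ[k + 1]? = some (cornerTarget v f)),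
      Complex.exp (-(Complex.I / 3) * ((Literature.Probability.LatticeModels.winding ((γ.map (medialPoint δ)).take (k + 2)) : ℝ) : ℂ)))
    ∂(bondPercolation (zdGraph 2) half)

/-- The `k`-th ℤ₄-harmonic of the class vector at `v`: `H_k(v) = Σ_c i^{kc} E_δ(v, f_c)`.
`H_0` is (up to `2 cos(π/12)`-type constants) the spin-1/3 vertex observable; `H_1, H_2, H_3` are the
spin-2/3, 5/3, 8/3 ≡ -4/3 ALIASES (same winding-number charge, class phases rotated). -/
def harmonic (Λ : ℝ → DiscreteDobrushin) (δ : ℝ) (k : ℕ) (v : Site 2) : ℂ :=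
  ∑ j : Fin 4, Complex.I ^ (k * (j : ℕ)) * cornerObs Λ δ v (cornerFaces v j)

/-- **HarmonicVanishing** (card `spin-aliasing-vertex-mode`, the transfer target `C⁺`): in every
Dobrushin domain and every discretisation family, the three non-trivial ℤ₄-harmonics of the class
vector — equivalently the spin-2/3, spin-5/3 and spin-4/3 dart observables summed around a primal
vertex — are `o(δ^{1/3})` locally uniformly. Exactly equivalent (finite Fourier inversion on ℤ₄) to
`EdgeCoherence` with the trivial character `u ≡ 1`; `H_3` is discharged by the DCS vertex relation
plus lattice-scale class equicontinuity, `H_1` is the DCS-invisible vertex-kernel mode. -/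
def HarmonicVanishing : Prop :=
  ∀ (D : DobrushinDomain) (Λ : ℝ → DiscreteDobrushin), (∀ δ, (Λ δ).Ω = D.carrier) →
    (∀ δ, (Λ δ).δ = δ) → (∀ᶠ δ in 𝓝[>] (0:ℝ), (Λ δ).IsZdAdmissible) →
    ∀ K : Set ℂ, IsCompact K → K ⊆ D.carrier → ∀ ε > (0:ℝ), ∀ᶠ δ in 𝓝[>] (0:ℝ),
      ∀ v : Site 2, meshPoint δ v ∈ K → ∀ k ∈ ({1, 2, 3} : Finset ℕ),
        ‖harmonic Λ δ k v‖ ≤ ε * δ ^ ((1:ℝ) / 3)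

/-- **First lemma of card `spin-aliasing-vertex-mode`** (exact, provable now): ℤ₄-Fourier inversion
`E_δ(v,f_c) = ¼ Σ_k i^{-kc} H_k(v)` gives `|E_δ(v,f) − E_δ(v,f′)| ≤ ½ (|H_1|+|H_2|+|H_3|)`, hence
`HarmonicVanishing → EdgeCoherence` with `u ≡ 1`. -/
def FirstLemmaAliasing : Prop := HarmonicVanishing → EdgeCoherence

/-- **RealRootedModulusAntitone** (card `lee-yang-winding-fugacity`, deterministic engine, provable
now; Aissen–Schoenberg–Whitney 1951 Thm 6 ⟺ Pólya-frequency): if a polynomial with non-negative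
leading constant has only real non-positive zeros, `P = c ∏ (X + rᵢ)`, `rᵢ ≥ 0`, then for every
`x > 0` the modulus `θ ↦ |P(x e^{iθ})|` is antitone on `[0, π]` (each factor
`|x e^{iθ} + r|² = x² + 2 r x cos θ + r²` decreases). Consequence used by the card: all rotated values
`|P(x e^{i(θ + kπ/2)})| ≤ |P(x e^{iθ})|` for `|θ| < π/4`, i.e. uniform boundedness of the
class-harmonic ratios on the sector `|arg ζ| < π/4` (edge = spin 1/2). -/
def RealRootedModulusAntitone : Prop :=
  ∀ (s : Multiset ℝ) (c x : ℝ), (∀ r ∈ s, 0 ≤ r) → 0 ≤ c → 0 < x →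
    AntitoneOn (fun θ : ℝ =>
      ‖(Polynomial.C (c : ℂ) * (s.map fun r => Polynomial.X + Polynomial.C (r : ℂ)).prod).eval
        ((x : ℂ) * Complex.exp ((θ : ℂ) * Complex.I))‖) (Set.Icc 0 Real.pi)

/-- The generating function of the lifted quarter-turn index at the primal vertex `v`:
`Z_δ(v)(ζ) = E[ Σ_{darts d at v used by γ} ζ^{m(d)} ]`, `m(d) = W(d)/(π/2) ∈ ℤ` (turns of the medial
exploration are `±π/2`, so `W ∈ (π/2)ℤ` exactly; `m mod 4` = class, `m div 4` = winding number).
`Z_δ(v)(e^{-iπ/6} · i^k) = H_k(v)`: the class harmonics are four values of ONE Laurent polynomial. -/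
def indexGF (Λ : ℝ → DiscreteDobrushin) (δ : ℝ) (v : Site 2) (ζ : ℂ) : ℂ :=
  ∫ ω, (let γ := medialExploration (Λ δ) ω;
    ∑ j : Fin 4, ∑ k ∈ (Finset.range γ.length).filter
      (fun k => γ[k]? = some (cornerSource v (cornerFaces v j)) ∧
        γ[k + 1]? = some (cornerTarget v (cornerFaces v j))),
      ζ ^ (round ((Literature.Probability.LatticeModels.winding ((γ.map (medialPoint δ)).take (k + 2))) / (Real.pi / 2)) : ℤ))
    ∂(bondPercolation (zdGraph 2) half)

/-- **WindingIndexRealRooted** (card `lee-yang-winding-fugacity`, THE BET = Lee–Yang property of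
the winding number): at every bulk vertex the Laurent polynomial `Z_δ(v)` has all its zeros on the
closed negative real axis (⟺ the index profile `m ↦ p_m(v)` is a Pólya frequency sequence). -/
def WindingIndexRealRooted : Prop :=
  ∀ (D : DobrushinDomain) (Λ : ℝ → DiscreteDobrushin), (∀ δ, (Λ δ).Ω = D.carrier) →
    (∀ δ, (Λ δ).δ = δ) → (∀ᶠ δ in 𝓝[>] (0:ℝ), (Λ δ).IsZdAdmissible) →
    ∀ K : Set ℂ, IsCompact K → K ⊆ D.carrier → ∀ᶠ δ in 𝓝[>] (0:ℝ),
      ∀ v : Site 2, meshPoint δ v ∈ K → ∀ ζ : ℂ, ζ ≠ 0 → indexGF Λ δ v ζ = 0 → ζ.im = 0 ∧ ζ.re < 0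

/-- **TiltedClassEquidistribution** (card `lee-yang-winding-fugacity`, the POSITIVE input): for real
fugacities `x` near `1` the rotated values are negligible, `Z_δ(v)(x i^k) = o(Z_δ(v)(x))`, `k = 1,2,3`
— i.e. under the positive tilt `x^{m}` of the lifted index the four dart classes (and the residues of
`m` mod 4) at `v` are asymptotically equidistributed: a ratio-limit statement for a POSITIVE measure
(tilted two-arm incipient-infinite-cluster uniqueness), with no cancellation. -/
def TiltedClassEquidistribution : Prop :=
  ∃ η > (0:ℝ), ∀ (D : DobrushinDomain) (Λ : ℝ → DiscreteDobrushin), (∀ δ, (Λ δ).Ω = D.carrier) →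
    (∀ δ, (Λ δ).δ = δ) → (∀ᶠ δ in 𝓝[>] (0:ℝ), (Λ δ).IsZdAdmissible) →
    ∀ K : Set ℂ, IsCompact K → K ⊆ D.carrier → ∀ ε > (0:ℝ), ∀ᶠ δ in 𝓝[>] (0:ℝ),
      ∀ v : Site 2, meshPoint δ v ∈ K → ∀ x : ℝ, |x - 1| < η → ∀ k ∈ ({1, 2, 3} : Finset ℕ),
        ‖indexGF Λ δ v ((x : ℂ) * Complex.I ^ k)‖ ≤ ε * ‖indexGF Λ δ v (x : ℂ)‖

/-- **SectorModulusDomination** (card `lee-yang-winding-fugacity`, the REPAIRED bet after the exact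
3×2 enumeration j006422 refuted real-rootedness at finite δ — zeros at `arg = ±116.9°, ±139.7°, ±143.0°,
180°` for the bulk vertex (1,1), all in the open left cone, none real-negative except two): for real
fugacities `x` near `1`, the modulus of `Z_δ(v)` anywhere on the circle `|ζ| = x` never exceeds `M` times
its modulus at a point of SMALLER `|arg|` inside the sector `|arg| < π/4`. Implied by real-rootedness
(`RealRootedModulusAntitone`, `M = 1`) and by the weaker damped-pair zero condition; it is exactly the
uniform bound `|Z(ζ i^k)| ≤ M |Z(ζ)|` on the sector that Vitali–Porter needs. (3×2 data: holds with
room — far-sector moduli are ≤ 3% of sector moduli; `|Z(x e^{iθ})|` is decreasing on `[0°, 120°–150°]`.) -/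
def SectorModulusDomination : Prop :=
  ∃ M η : ℝ, 0 < η ∧ ∀ (D : DobrushinDomain) (Λ : ℝ → DiscreteDobrushin), (∀ δ, (Λ δ).Ω = D.carrier) →
    (∀ δ, (Λ δ).δ = δ) → (∀ᶠ δ in 𝓝[>] (0:ℝ), (Λ δ).IsZdAdmissible) →
    ∀ K : Set ℂ, IsCompact K → K ⊆ D.carrier → ∀ᶠ δ in 𝓝[>] (0:ℝ),
      ∀ v : Site 2, meshPoint δ v ∈ K → ∀ x : ℝ, |x - 1| < η → ∀ θ θ' : ℝ, |θ| ≤ |θ'| → |θ| < Real.pi / 4 →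
        |θ'| ≤ Real.pi →
        ‖indexGF Λ δ v ((x : ℂ) * Complex.exp ((θ' : ℂ) * Complex.I))‖ ≤
          M * ‖indexGF Λ δ v ((x : ℂ) * Complex.exp ((θ : ℂ) * Complex.I))‖

/-- **ArcRotatedDomination** (card `lee-yang-winding-fugacity`, the MINIMAL normality hypothesis,
adopted after the 3×3 enumeration j006423 showed a zero ON the unit circle at `arg = ±108°` for the
centre vertex — harmless for Vitali, but violating the monotone phrasing of
`SectorModulusDomination`): on a thin neighbourhood of the arc from `1` to `ζ₀ = e^{−iπ/6}` the three
rotated values never dominate: `|Z(ζ i^k)| ≤ M |Z(ζ)|`, `k = 1,2,3`, for `ζ = x e^{iθ}`,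
`|x − 1| < η`, `θ ∈ [−π/6 − η, η]`. This is exactly local boundedness of `R_k = Z(· i^k)/Z` on a
connected open set containing the real segment and `ζ₀` — what Vitali–Porter consumes — and at the
endpoint it is the a-priori comparability `|H_k(v)| ≤ M |H_0(v)|` (bounded, not small: the
continuation upgrades bounded to `→ 0`). Data: `M ≤ 0.51` on 3×2 and 3×3 (all six bulk vertices, all
`x ∈ {0.8, 1, 1.25}`); Gaussian picture: `M = e^{−cV} → 0`. -/
def ArcRotatedDomination : Prop :=
  ∃ M η : ℝ, 0 < η ∧ ∀ (D : DobrushinDomain) (Λ : ℝ → DiscreteDobrushin), (∀ δ, (Λ δ).Ω = D.carrier) →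
    (∀ δ, (Λ δ).δ = δ) → (∀ᶠ δ in 𝓝[>] (0:ℝ), (Λ δ).IsZdAdmissible) →
    ∀ K : Set ℂ, IsCompact K → K ⊆ D.carrier → ∀ᶠ δ in 𝓝[>] (0:ℝ),
      ∀ v : Site 2, meshPoint δ v ∈ K → ∀ x θ : ℝ, |x - 1| < η → -(Real.pi / 6) - η ≤ θ → θ ≤ η →
        ∀ k ∈ ({1, 2, 3} : Finset ℕ),
        ‖indexGF Λ δ v ((x : ℂ) * Complex.exp ((θ : ℂ) * Complex.I) * Complex.I ^ k)‖ ≤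
          M * ‖indexGF Λ δ v ((x : ℂ) * Complex.exp ((θ : ℂ) * Complex.I))‖

/-- **AliasCurrentConserved** (card `spin-aliasing-vertex-mode`, exact structural reformulation,
verified to `3·10⁻¹³` by the enumeration j006422): in the spin-2/3 gauge the DCS vertex relation IS
flux conservation of the alias current `J(d) = E[ζ₁^{m(d)}; d ∈ γ]`, `ζ₁ = e^{iπ/3}`, at every interior
medial vertex: outgoing darts (positions NW, SE of a horizontal lattice edge = corners `(x,x)`,
`(x+e₀, x−e₁)`) balance incoming ones (NE, SW = `(x+e₀,x)`, `(x,x−e₁)`), and similarly at vertical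
edges. Consequence (planar digraph whose faces are directed 4-cycles): `J(v,f) = Ψ(v) − Ψ(f)` for an
exact STREAM FUNCTION `Ψ` on vertices ∪ faces, `H_1(v) ∝ 4Ψ(v) − Σ_{f∋v} Ψ(f)` (union-lattice
Laplacian), `H_0, H_2 ∝` the two complex gradients of `Ψ`, `H_3 ∝` its mixed second difference:
EdgeCoherence ⟺ `Ψ` asymptotically discrete-harmonic and holomorphic-dominated at leading order. -/
def AliasCurrentConserved : Prop :=
  ∀ (E : DiscreteDobrushin), E.IsZdAdmissible → ∀ x : Site 2,
    (∀ y ∈ ({x, x + Pi.single 0 1, x - Pi.single 1 1, x + Pi.single 0 1 - Pi.single 1 1} : Set (Site 2)),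
      ∀ i : Fin 2, E.IsInnerFace y ∧ s(y, y + Pi.single i 1) ∈ (zdGraph 2).edgeSet) →
    let J : Site 2 → Site 2 → ℂ := fun v f => ∫ ω, (let γ := medialExploration E ω;
      ∑ k ∈ (Finset.range γ.length).filter
        (fun k => γ[k]? = some (cornerSource v f) ∧ γ[k + 1]? = some (cornerTarget v f)),
        Complex.exp (↑(Real.pi / 3) * Complex.I) ^
          (round ((Literature.Probability.LatticeModels.winding ((γ.map (medialPoint E.δ)).take (k + 2))) / (Real.pi / 2)) : ℤ))
      ∂(bondPercolation (zdGraph 2) half)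
    J x x + J (x + Pi.single 0 1) (x - Pi.single 1 1) =
      J (x + Pi.single 0 1) x + J x (x - Pi.single 1 1)

/-- **First lemma of card `lee-yang-winding-fugacity`** (the Vitali transfer, deterministic given the
three inputs): real-rootedness makes `ζ ↦ Z_δ(v)(ζ i^k)/Z_δ(v)(ζ)` holomorphic and bounded by `1` on
the sector `|arg ζ| < π/4` (RealRootedModulusAntitone), the positive-fugacity input makes it tend to
`0` on a real segment, so Vitali–Porter gives `H_k(v) = Z(e^{-iπ/6} i^k) = o(|Z(e^{-iπ/6})|)
= o(|H_0(v)|)`: PROJECTIVE coherence; with the envelope `|H_0| ≤ C δ^{1/3}` (EdgePrecompact (i) type)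
this is `HarmonicVanishing`, hence `EdgeCoherence`. -/
def FirstLemmaLeeYang : Prop :=
  ArcRotatedDomination → TiltedClassEquidistribution →
    (∀ (D : DobrushinDomain) (Λ : ℝ → DiscreteDobrushin), (∀ δ, (Λ δ).Ω = D.carrier) →
      (∀ δ, (Λ δ).δ = δ) → (∀ᶠ δ in 𝓝[>] (0:ℝ), (Λ δ).IsZdAdmissible) →
      ∀ K : Set ℂ, IsCompact K → K ⊆ D.carrier → ∃ C : ℝ, ∀ᶠ δ in 𝓝[>] (0:ℝ),
        ∀ v : Site 2, meshPoint δ v ∈ K → ‖harmonic Λ δ 0 v‖ ≤ C * δ ^ ((1:ℝ) / 3)) →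
    HarmonicVanishing

/-! ## Card `fixed-radius-equivariant-cut` (generation 2, 2026-08-16)

The cut is at a FIXED lattice radius `ρ` (independent of the mesh): the inner object below never
sees `δ`, a domain, a family or a compact. -/

section OneCut

open scoped Classical

/-- The closed lattice ball of radius `ρ` about the origin in squared-Euclidean form (invariant
under the rotation by `π/2` about the origin, which is the symmetry the cut exploits). -/
def InBall (ρ : ℕ) (x : Site 2) : Prop := x 0 ^ 2 + x 1 ^ 2 ≤ (ρ : ℤ) ^ 2

/-- Rotation by `π/2` about the origin acting on sites and on coded corners: `(v, k) ↦ (Rv, k+1)`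
(`cornerUnit (k+1) = R (cornerUnit k)`). -/
def rotSite (x : Site 2) : Site 2 := ![-(x 1), x 0]

/-- Rotation of a coded corner (see `rotSite`). -/
def rotCorner (e : Site 2 × Fin 4) : Site 2 × Fin 4 := (rotSite e.1, e.2 + 1)

/-- Rotation of a bond configuration by `π/2` about the origin. -/
def rotConfig (β : BondConfig (Site 2)) : BondConfig (Site 2) := {e | e.map rotSite ∈ β}

/-- Translate a coded corner by `-v` (to centre the inner tensor at the vertex `v`). -/
def shiftCorner (e : Site 2 × Fin 4) (v : Site 2) : Site 2 × Fin 4 := (e.1 - v, e.2)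

/-- The QUENCHED inner configuration: inner–inner edges (both endpoints in the ball) are read from
the random `ω`, every other edge — in particular the ~8ρ edges CROSSING the cut circle, which both
the outer segment and the inner orbit examine — is frozen to the boundary condition `β` (part of the
label of the cut; this is what makes the outer and inner factors independent). -/
def mixCfg (ρ : ℕ) (β ω : BondConfig (Site 2)) : BondConfig (Site 2) :=
  {e | (e ∈ ω ∧ ∀ x ∈ e, InBall ρ x) ∨ (e ∈ β ∧ ∃ x ∈ e, ¬ InBall ρ x)}

/-- `InnerHit ρ β' e c n`: the forward medial orbit (`cornerOrbit`, successor map `nextCorner`) of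
the configuration `β'` started at the corner `e` is at the centre corner `(0, c)` at time `n`, having
stayed inside the ball at all times `1, …, n` (so `e` is the LAST ENTRY corner before the passage; at
most one `n` qualifies, since an orbit through an outside corner cannot be periodic inside). -/
def InnerHit (ρ : ℕ) (β' : BondConfig (Site 2)) (e : Site 2 × Fin 4) (c : Fin 4) (n : ℕ) : Prop :=
  cornerOrbit β' e n = (0, c) ∧ ∀ m, 0 < m → m ≤ n → InBall ρ (cornerOrbit β' e m).1

/-- **The δ-free inner response tensor** of the lattice ball `B_ρ` with boundary condition `β`
(card `fixed-radius-equivariant-cut`):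
`T_ρ(β; e, c) = E_inner[ exp(-(i/3)(π/2) S) ; the orbit from the boundary corner e reaches (0,c) inside B_ρ ]`,
`S = Σ_{i<n} turnSign` the turning (in quarter turns) accumulated from `e` to the centre dart — the
inner factor of the item's integrand (`Negative.dartPhaseSum_eq_exp_turnSign`), the expectation
running over the inner–inner edges only (`mixCfg`). Zero unless `e` is adjacent to the ball from
outside. The Monte-Carlo j012717 measures its ANNEALED version (β i.i.d. as well). -/
def innerResp (ρ : ℕ) (β : BondConfig (Site 2)) (e : Site 2 × Fin 4) (c : Fin 4) : ℂ :=
  ∫ ω, (∑' n : ℕ, if InnerHit ρ (mixCfg ρ β ω) e c n then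
      Complex.exp (-(Complex.I / 3) * ((Real.pi / 2 *
        ∑ i ∈ Finset.range n, (turnSign (mixCfg ρ β ω) (cornerOrbit (mixCfg ρ β ω) e i) : ℝ) : ℝ) : ℂ))
      else 0)
    ∂(bondPercolation (zdGraph 2) half)

/-- The `k`-th ℤ₄-harmonic (in the centre class `c`) of the inner response from the entry corner `e`
under the boundary condition `β`: `T̂_ρ(β;e,k) = Σ_c i^{kc} T_ρ(β;e,c)`; `k = 0` is the inner spin-1/3
SIGNAL, `k = 1,2,3` the inner ALIASES. -/
def innerHarmonic (ρ : ℕ) (β : BondConfig (Site 2)) (e : Site 2 × Fin 4) (k : ℕ) : ℂ :=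
  ∑ c : Fin 4, Complex.I ^ (k * (c : ℕ)) * innerResp ρ β e c

/-- **ℤ₄-equivariance of the inner tensor** (provable now, size S: rotate the configuration by `π/2`
about the origin — a measure-preserving bijection of the i.i.d. measure commuting with `nextCorner`,
`turnSign`, `mixCfg` and `InBall`): `T_ρ(Rβ; Re, c+1) = T_ρ(β; e, c)`; hence
`T̂_ρ(Rβ; Re, k) = i^{-k} T̂_ρ(β; e, k)`, and for ℤ₄-symmetric (e.g. annealed) boundary data ONE centre
class suffices: `T_ρ(e,c) = T_ρ(R^{-c}e, 0)`. -/
def InnerRespEquivariant : Prop :=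
  ∀ (ρ : ℕ) (β : BondConfig (Site 2)) (e : Site 2 × Fin 4) (c : Fin 4),
    innerResp ρ (rotConfig β) (rotCorner e) (c + 1) = innerResp ρ β e c

/-- **InnerUniformCoherence** — the card's transfer target `C⁺` (δ-free, domain-free, family-free):
the inner alias harmonics are asymptotically negligible against the inner signal harmonic, UNIFORMLY
in the boundary condition `β` and the entry corner `e`, as the lattice radius grows:
`sup_{β,e} ‖T̂_ρ(β;e,k)‖ / ‖T̂_ρ(β;e,0)‖ → 0` (`k = 1,2,3`), stated without division. (Annealed MC
j012717, 5.3·10⁵ orbits: orbit-aggregated `k = 1` ratio 0.578, 0.522, 0.490, 0.442, 0.413, 0.381,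
0.347, 0.313, 0.289, 0.265, 0.244, 0.225, 0.209 at `ρ = 2 … 128`, log-log slope −0.248 ≈ −1/4; sup
over entry orbits ≈ 1.1× the aggregate up to ρ = 23; quenched smoke runs: frozen β move it ≤ 5 %.) -/
def InnerUniformCoherence : Prop :=
  ∀ k ∈ ({1, 2, 3} : Finset ℕ), ∀ ε > (0:ℝ), ∀ᶠ ρ : ℕ in atTop, ∀ (β : BondConfig (Site 2))
    (e : Site 2 × Fin 4), ¬ InBall ρ e.1 → ‖innerHarmonic ρ β e k‖ ≤ ε * ‖innerHarmonic ρ β e 0‖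

/-- **OneCutPresentation** (the exact cut + the two outer-side inputs, bundled): for every domain,
family and compact there are a constant `C` (uniform in `ρ`!) and a null sequence `η` such that for
every lattice radius `ρ`, eventually in `δ`, at every vertex `v` over `K` the class vector is
PRESENTED through the inner tensor centred at `v`:
`E_δ(v, f_c) = Σ_{(β,e)} A(β,e) · T_ρ(β; e − v, c) + r(c)` with
(i) `A(β,e) = E_outer[ phase of γ up to e ; γ FIRST enters the ball at e, boundary edges in state β ]`
— outer-measurable, so the first-entry term factorises EXACTLY (independent inner–inner / other
edges, domain Markov property of the exploration); (ii) the OUTER ABSOLUTE ENVELOPE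
`Σ ‖A(β,e)‖ ‖T̂_ρ(β; e − v, 0)‖ ≤ C δ^{1/3}` (absolute factorisation of the spin-1/3 envelope at a
fixed lattice radius costs a constant); (iii) the REMAINDER `r` — passages of `v` on a LATER entry into
the ball (a ρ-independent fraction of the mass, geometrically small in the number of cut crossings by
RSW/BK) — has alias harmonics `≤ η(ρ) δ^{1/3}`: to be discharged by the SAME uniform coherence for the
DECORATED inner tensors of labels with ≤ k₀(ρ) earlier inner arcs (boundary-scale wiggles that do not
consume the inner scales) plus the small absolute mass of the complexity tail. (i) is combinatorics
(size M), (ii) is crux-#3-type input in factorised form, (iii) is the second stub of the line. -/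
def OneCutPresentation : Prop :=
  ∀ (D : DobrushinDomain) (Λ : ℝ → DiscreteDobrushin), (∀ δ, (Λ δ).Ω = D.carrier) →
    (∀ δ, (Λ δ).δ = δ) → (∀ᶠ δ in 𝓝[>] (0:ℝ), (Λ δ).IsZdAdmissible) →
    ∀ K : Set ℂ, IsCompact K → K ⊆ D.carrier →
      ∃ C : ℝ, ∃ η : ℕ → ℝ, Tendsto η atTop (𝓝 0) ∧ ∀ ρ : ℕ, ∀ᶠ δ in 𝓝[>] (0:ℝ),
        ∀ v : Site 2, meshPoint δ v ∈ K →
          ∃ (A : BondConfig (Site 2) × (Site 2 × Fin 4) → ℂ) (r : Fin 4 → ℂ), A.support.Finite ∧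
            (∀ c : Fin 4, cornerObs Λ δ v (cornerFaces v c) =
              (∑ᶠ l, A l * innerResp ρ l.1 (shiftCorner l.2 v) c) + r c) ∧
            (∑ᶠ l, ‖A l‖ * ‖innerHarmonic ρ l.1 (shiftCorner l.2 v) 0‖) ≤ C * δ ^ ((1:ℝ) / 3) ∧
            ∀ k ∈ ({1, 2, 3} : Finset ℕ),
              ‖∑ c : Fin 4, Complex.I ^ (k * (c : ℕ)) * r c‖ ≤ η ρ * δ ^ ((1:ℝ) / 3)

/-- **The algebraic core of the cut** (provable now, size S; triangle inequality): if every label's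
inner response has alias harmonics at most `ε` times its signal harmonic, then pairing with ANY
complex outer weights keeps that ratio against the absolutely-factorised signal mass — the outer
problem enters only through `‖A‖`. -/
def OneCutHarmonicBound : Prop :=
  ∀ (L : Type) [Fintype L] (A : L → ℂ) (B : L → Fin 4 → ℂ) (ε : ℝ), 0 ≤ ε →
    (∀ l, ∀ k ∈ ({1, 2, 3} : Finset ℕ),
      ‖∑ c : Fin 4, Complex.I ^ (k * (c : ℕ)) * B l c‖ ≤ ε * ‖∑ c : Fin 4, B l c‖) →
    ∀ k ∈ ({1, 2, 3} : Finset ℕ),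
      ‖∑ l, A l * ∑ c : Fin 4, Complex.I ^ (k * (c : ℕ)) * B l c‖ ≤
        ε * ∑ l, ‖A l‖ * ‖∑ c : Fin 4, B l c‖

/-- **First lemma of card `fixed-radius-equivariant-cut`**: the one-cut presentation and the δ-free
inner uniform coherence give `HarmonicVanishing` (hence `EdgeCoherence` with `u ≡ 1` by
`FirstLemmaAliasing`). Proof: `H_k(v) = Σ_l A(l) T̂_ρ(l; k) + r̂(k)` (linearity of the presentation
in `c`), `‖·‖ ≤ ε Σ_l ‖A(l)‖ ‖T̂_ρ(l; 0)‖ + η(ρ) δ^{1/3} ≤ (ε C + η(ρ)) δ^{1/3}` by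
`OneCutHarmonicBound`; choose `ρ` (large, fixed) first, then `δ` small — no rate is ever needed,
which is exactly what the item asks. -/
def FirstLemmaOneCut : Prop := OneCutPresentation → InnerUniformCoherence → HarmonicVanishing

end OneCut

end

end Summit.CriticalPhenomena.CardyFormulaZ2.Cruxes.EdgeCoherence.Sketch
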